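import Literature.Probability.RandomPlanarGeometry.HexSAWStripSurfaceThresholdRate
import Mathlib.Analysis.SpecificLimits.Basic
import HarnessLib

/-!
# A threshold bootstrap for the strip bridge coefficients: identity (E) + one contact cut (C) ⇒ no decay at `y_T`

Beaton–Bousquet-Mélou–de Gier–Duminil-Copin–Guttmann [BBdGDCG, arXiv:1109.0358v5], §3.2 and §4.  For the width-`T` strip of the
honeycomb lattice at `x = x_c` write `B_T(x_c; y) = Σ_{m ≥ 1} β_{T,m} y^m` (bridges by top contacts; `HV.stripBcoeff`) and
`A_T(x_c; y) = Σ_m α_{T,m} y^m` (arches; `HV.stripAcoeff`); both have radius `y_T` (`HV.stripYT`, Corollary 8), and `y* < y_T`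
(`HV.yStar_lt_stripYT`).  The lane's open question (R2) asks for a LINEAR lower law `Σ_{m ≤ M} β_{T,m} y_T^m ≥ s·M`; the tree has
the `√M` law (THRESHOLD+, `HV.exists_sqrt_le_stripGFy_beta_stripYT`) and the lane has the linear law CONDITIONAL on the rationality
of `B_T(x_c; ·)` (`StripBridgeSeriesRational`, via a pole/Tauberian argument).

This file isolates a DIFFERENT, elementary mechanism that needs no rationality and no Perron–Frobenius input, and states its two
combinatorial inputs as HYPOTHESES (not proved here):

* (E) `HV.StripCoeffIdentity T` (a named `def … : Prop`, since it is print read coefficientwise): `β_{T,m} − y*·β_{T,m+1} = κ·α_{T,m}`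
  (`m ≥ 1`, some `κ > 0`) — Proposition 9, eq. (18) (arXiv v5 p. 14) read coefficientwise;
* (C) an explicit hypothesis BINDER `hC` (no named def — it is a lane statement, not print):
  `∃ K > 0, ∀ m n ≥ 1, α_{T,m+n−1} ≤ K·β_{T,m}·β_{T,n}` — the arch-into-two-bridges cut of eq. (20), indexed by top contacts.

§1 (namespace `…SAW.ThresholdBootstrap`, abstract sequences `u, a ≥ 0`, `q > 1`): from (E′) `u m − u (m+1)/q = κ a m`, (C′)
`a (m+n−1) ≤ K u m u n`, (R) `u N / q^N → 0` and (D) `Σ_{m ≤ M} u m` unbounded: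
* `eq_kappa_sum_add_remainder`, `le_of_forall_coeff_le` — `u m = κ Σ_{m ≤ i < N} a i q^{−(i−m)} + u N q^{−(N−m)}`, hence
  `a ≤ t` on `[m, ∞)` forces `u m ≤ κ t q/(q−1)`; `exists_large_coeff` — a large `u j` forces a large `a i`, `i ≥ j`;
* ★ `not_tendsto_zero_of_identity_cut` — `u ↛ 0`: if `u → 0`, (E′)+(C′) give `sup_{i ≥ 2j} u ≤ C·(sup_{i ≥ j} u)²`, a doubly exponential
  decay along dyadic blocks, and the partial sums stay bounded, contradicting (D);
* ★★ `exists_linear_io_of_identity_cut` — `∃ s > 0, ∀ M₀, ∃ M ≥ M₀, s·M ≤ Σ_{m ≤ M} u m`: a large `a i` makes every split `m + n − 1 = i`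
  carry `u m · u n ≥ p`, so half of `u 1, …, u i` are `≥ √p`.

§2 (namespace `…SAW.HV`): the dictionary `u m = β_{T,m} y_T^m`, `a m = α_{T,m} y_T^m`, `q = y_T/y*` (`bootstrap_hypotheses`; (R) is
`tendsto_stripBcoeff_mul_yStar_pow`, (D) is `partialSum_stripBcoeff_stripYT_unbounded`, both proved from the tree), the doors, and
★ `not_tendsto_zero_stripBcoeff_mul_stripYT_pow`, ★★ `exists_linear_io_partialSum_stripBcoeff_stripYT`: GIVEN (E) and (C), for every
`T ≥ 1` the coefficients `β_{T,m} y_T^m` do not tend to `0` and the partial sums are linear along a subsequence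
(`limsup_M M⁻¹ Σ_{m ≤ M} β_{T,m} y_T^m > 0`).

§1/§2 also carry the UPGRADE UNDER BOUNDEDNESS (`exists_pos_le_of_bounded`, `exists_linear_le_partialSum_of_bounded`; lane:
hypothesis binder (B) `hB : ∃ U, ∀ m, β_{T,m} y_T^m ≤ U` = the linear UPPER law (no named def), and ★★★ `exists_pos_le_stripBcoeff_mul_stripYT_pow`,
`exists_linear_le_partialSum_stripBcoeff_stripYT`): GIVEN (E), (C), (B), `β_{T,m} y_T^m ≥ c > 0` for all `m ≥ 1` and the linear lower law
holds for ALL `M` — "upper law ⇒ lower law", for every `T ≥ 1`, without rationality.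

NOT claimed: the hypotheses (E), (C), (B) themselves; the linear law for ALL `M` without (B) (the bootstrap alone gives it
along a subsequence only); anything about the order of the pole.  The bootstrap of §1 is the lane's own elementary argument; the cited
places are where its inputs live.
-/

noncomputable section

open Finset Filter Topology

/-! ## §1 The abstract bootstrap: sequences `u, a ≥ 0`, ratio `q > 1`, identity (E′), cut (C′), radius (R), divergence (D) -/

namespace Literature.Probability.RandomPlanarGeometry.SAW.ThresholdBootstrap

variable {u a : ℕ → ℝ} {q κ K : ℝ}

/-- Growth control from the coefficient identity: `u (m+1) ≤ q · u m`. [cite: BeatonBousquetMelouDeGierDuminilCopinGuttmann2014, Proposition 9, eq. (18) (arXiv v5 p. 14, §4.3) — coefficientwise; lane: elementary] -/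
theorem succ_le_q_mul (ha : ∀ m, 0 ≤ a m) (hq : 0 < q) (hκ : 0 ≤ κ)
    (hE : ∀ m, 1 ≤ m → u m - u (m + 1) / q = κ * a m) {m : ℕ} (hm : 1 ≤ m) :
    u (m + 1) ≤ q * u m := by
  have h := hE m hm
  have h1 : 0 ≤ κ * a m := mul_nonneg hκ (ha m)
  have h2 : u (m + 1) / q ≤ u m := by linarith
  rwa [div_le_iff₀ hq, mul_comm] at h2

/-- The arch coefficient is dominated by the bridge coefficient: `κ · a m ≤ u m`. [cite: BeatonBousquetMelouDeGierDuminilCopinGuttmann2014, Proposition 9, eq. (18) (arXiv v5 p. 14, §4.3) — coefficientwise; lane: elementary] -/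
theorem kappa_mul_coeff_le_of_identity (hu : ∀ m, 0 ≤ u m) (hq : 0 < q)
    (hE : ∀ m, 1 ≤ m → u m - u (m + 1) / q = κ * a m) {m : ℕ} (hm : 1 ≤ m) :
    κ * a m ≤ u m := by
  have h := hE m hm
  have h1 : 0 ≤ u (m + 1) / q := div_nonneg (hu _) hq.le
  linarith

/-- Finite telescoping of the identity: `u m = κ Σ_{m ≤ i < N} a i / q^{i−m} + u N / q^{N−m}`.
[cite: BeatonBousquetMelouDeGierDuminilCopinGuttmann2014, Proposition 9, eq. (18) (arXiv v5 p. 14, §4.3) — iterated; lane: elementary] -/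
theorem eq_kappa_sum_add_remainder (hq : 0 < q) (hE : ∀ m, 1 ≤ m → u m - u (m + 1) / q = κ * a m) {m : ℕ} (hm : 1 ≤ m)
    {N : ℕ} (hN : m ≤ N) :
    u m = κ * ∑ i ∈ Ico m N, a i / q ^ (i - m) + u N / q ^ (N - m) := by
  induction N, hN using Nat.le_induction with
  | base => simp
  | succ N hmN ih =>
    have hq0 : q ≠ 0 := hq.ne'
    have h := hE N (hm.trans hmN)
    rw [Finset.sum_Ico_succ_top hmN, mul_add, ih]
    have h1 : u N = κ * a N + u (N + 1) / q := by linarith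
    have h2 : N + 1 - m = (N - m) + 1 := by omega
    rw [h1, h2, pow_succ, add_div, mul_div_assoc]
    have h3 : u (N + 1) / q / q ^ (N - m) = u (N + 1) / (q ^ (N - m) * q) := by
      rw [div_div, mul_comm]
    rw [← h3]
    ring

/-- If `a i ≤ t` for all `i ≥ m`, then `u m ≤ κ t · q/(q − 1)` (the remainder `u N / q^{N−m}` tends to `0`).
[cite: BeatonBousquetMelouDeGierDuminilCopinGuttmann2014, Proposition 9, eq. (18) (arXiv v5 p. 14, §4.3) with Corollary 8 (p. 12: radius, hence summability below it); lane: elementary] -/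
theorem le_of_forall_coeff_le (ha : ∀ m, 0 ≤ a m) (hq : 1 < q) (hκ : 0 ≤ κ)
    (hE : ∀ m, 1 ≤ m → u m - u (m + 1) / q = κ * a m)
    (hR : Tendsto (fun N => u N / q ^ N) atTop (𝓝 0)) {m : ℕ} (hm : 1 ≤ m) {t : ℝ}
    (ht : ∀ i, m ≤ i → a i ≤ t) : u m ≤ κ * t * (q / (q - 1)) := by
  have hq0 : 0 < q := by linarith
  have hq1 : (0 : ℝ) ≤ 1 / q := by positivity
  have hq2 : 1 / q < 1 := by rw [div_lt_one hq0]; exact hq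
  have ht0 : 0 ≤ t := (ha m).trans (ht m le_rfl)
  -- the bound for each `N ≥ m`
  have hmain : ∀ N, m ≤ N → u m ≤ κ * t * (q / (q - 1)) + q ^ m * (u N / q ^ N) := by
    intro N hN
    rw [eq_kappa_sum_add_remainder hq0 hE hm hN]
    have h1 : ∑ i ∈ Ico m N, a i / q ^ (i - m) ≤ t * (q / (q - 1)) := by
      calc ∑ i ∈ Ico m N, a i / q ^ (i - m) ≤ ∑ i ∈ Ico m N, t * (1 / q) ^ (i - m) := by
            apply Finset.sum_le_sum
            intro i hi
            rw [Finset.mem_Ico] at hi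
            rw [one_div_pow, mul_one_div]
            exact div_le_div_of_nonneg_right (ht i hi.1) (pow_pos hq0 _).le
        _ = t * ∑ j ∈ range (N - m), (1 / q) ^ j := by
            rw [Finset.mul_sum, Finset.sum_Ico_eq_sum_range]
            refine Finset.sum_congr rfl fun j _ => ?_
            rw [Nat.add_sub_cancel_left]
        _ ≤ t * (q / (q - 1)) := by
            apply mul_le_mul_of_nonneg_left _ ht0
            have hg := geom_sum_Ico_le_of_lt_one (m := 0) (n := N - m) hq1 hq2
            rw [← Finset.range_eq_Ico, pow_zero] at hg
            have : (1 : ℝ) / (1 - 1 / q) = q / (q - 1) := by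
              field_simp
            linarith [this ▸ hg]
    have h2 : u N / q ^ (N - m) = q ^ m * (u N / q ^ N) := by
      rw [mul_div_assoc', div_eq_div_iff (pow_ne_zero _ hq0.ne') (pow_ne_zero _ hq0.ne')]
      have : q ^ N = q ^ m * q ^ (N - m) := by rw [← pow_add, show m + (N - m) = N by omega]
      rw [this]; ring
    rw [h2]
    nlinarith [mul_le_mul_of_nonneg_left h1 hκ]
  have hlim : Tendsto (fun N => κ * t * (q / (q - 1)) + q ^ m * (u N / q ^ N)) atTop
      (𝓝 (κ * t * (q / (q - 1)) + q ^ m * 0)) :=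
    tendsto_const_nhds.add (tendsto_const_nhds.mul hR)
  rw [mul_zero, add_zero] at hlim
  exact ge_of_tendsto hlim ((eventually_ge_atTop m).mono hmain)

/-- Contrapositive: if `u j ≥ ε > 0` then some `a i`, `i ≥ j`, exceeds `ε (q−1)/(2κq)`.
[cite: BeatonBousquetMelouDeGierDuminilCopinGuttmann2014, Proposition 9, eq. (18) (arXiv v5 p. 14, §4.3); lane: elementary] -/
theorem exists_large_coeff (ha : ∀ m, 0 ≤ a m) (hq : 1 < q) (hκ : 0 < κ)
    (hE : ∀ m, 1 ≤ m → u m - u (m + 1) / q = κ * a m)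
    (hR : Tendsto (fun N => u N / q ^ N) atTop (𝓝 0)) {j : ℕ} (hj : 1 ≤ j) {ε : ℝ} (hε : 0 < ε)
    (hεu : ε ≤ u j) : ∃ i, j ≤ i ∧ ε * (q - 1) / (2 * κ * q) < a i := by
  by_contra! h
  have h1 := le_of_forall_coeff_le ha hq hκ.le hE hR hj h
  have hq1 : 0 < q - 1 := by linarith
  have hq0 : 0 < q := by linarith
  have h2 : κ * (ε * (q - 1) / (2 * κ * q)) * (q / (q - 1)) = ε / 2 := by
    field_simp
  linarith

/-- `2k ≤ 2^k`. [cite: BeatonBousquetMelouDeGierDuminilCopinGuttmann2014, §3.2 (bookkeeping for the dyadic blocks); lane: elementary]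
(ed.5: `private` twin — the same inequality is a public theorem of an unrelated tree module,
`Literature.NumberTheory.EllipticCurves.two_mul_le_two_pow`, which this file does not import.) -/
private theorem two_mul_le_two_pow_self (k : ℕ) : 2 * k ≤ 2 ^ k := by
  induction k with
  | zero => simp
  | succ k ih =>
    rcases Nat.eq_zero_or_pos k with rfl | hk
    · simp
    · have : 2 ≤ 2 ^ k := by
        calc 2 = 2 ^ 1 := by norm_num
          _ ≤ 2 ^ k := Nat.pow_le_pow_right (by norm_num) hk
      rw [pow_succ]; omega

/-- The dyadic weights are summable: `Σ_{k<n} 2^k (1/2)^{2^k} ≤ 2`. [cite: BeatonBousquetMelouDeGierDuminilCopinGuttmann2014, §3.2 (bookkeeping); lane: elementary] -/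
theorem sum_two_pow_mul_half_pow_le (n : ℕ) : ∑ k ∈ range n, (2 : ℝ) ^ k * (1 / 2) ^ (2 ^ k) ≤ 2 := by
  have h1 : ∀ k ∈ range n, (2 : ℝ) ^ k * (1 / 2) ^ (2 ^ k) ≤ (1 / 2) ^ k := by
    intro k _
    have h2 : (2 : ℝ) ^ k * 2 ^ k ≤ 2 ^ (2 ^ k) := by
      rw [← pow_add]
      exact pow_le_pow_right₀ (by norm_num) (by have := two_mul_le_two_pow_self k; omega)
    have h3 : (0 : ℝ) < 2 ^ (2 ^ k) := by positivity
    have h4 : (0 : ℝ) < 2 ^ k := by positivity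
    rw [one_div_pow, one_div_pow, mul_one_div, div_le_div_iff₀ h3 h4, one_mul]
    nlinarith
  calc ∑ k ∈ range n, (2 : ℝ) ^ k * (1 / 2) ^ (2 ^ k) ≤ ∑ k ∈ range n, ((1 : ℝ) / 2) ^ k := Finset.sum_le_sum h1
    _ ≤ 2 := by
        have hg := geom_sum_Ico_le_of_lt_one (m := 0) (n := n) (x := (1 : ℝ) / 2) (by norm_num) (by norm_num)
        rw [← Finset.range_eq_Ico, pow_zero] at hg
        norm_num at hg ⊢
        exact hg

/-- ★ BOOTSTRAP, first half: under the coefficient identity (E), the contact cut (C), the radius condition (R) and divergence (D),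
the normalised coefficients `u m` do NOT tend to `0`.  (If they did, (E)+(C) give `sup_{i ≥ 2j} u ≤ C (sup_{i ≥ j} u)²`, a doubly
exponential decay along dyadic blocks, contradicting (D).) [cite: BeatonBousquetMelouDeGierDuminilCopinGuttmann2014, Proposition 9, eq. (18) (arXiv v5 p. 14, §4.3) and §4.5 eq. (20) (p. 15: "by looking at its last contact, one can factor the arch into two bridges"); lane: the bootstrap is the lane's] -/
theorem not_tendsto_zero_of_identity_cut (hu : ∀ m, 0 ≤ u m) (ha : ∀ m, 0 ≤ a m) (hq : 1 < q) (hκ : 0 < κ) (hK : 0 < K)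
    (hE : ∀ m, 1 ≤ m → u m - u (m + 1) / q = κ * a m)
    (hC : ∀ m n, 1 ≤ m → 1 ≤ n → a (m + n - 1) ≤ K * u m * u n)
    (hR : Tendsto (fun N => u N / q ^ N) atTop (𝓝 0))
    (hD : ∀ B : ℝ, ∃ M : ℕ, B < ∑ m ∈ range (M + 1), u m) :
    ¬ Tendsto u atTop (𝓝 0) := by
  intro hlim
  have hq1 : 0 < q - 1 := by linarith
  set C : ℝ := κ * K * (q / (q - 1)) with hCdef
  have hC0 : 0 < C := by positivity
  set δ : ℝ := 1 / (2 * C) with hδdef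
  have hδ : 0 < δ := by positivity
  obtain ⟨N, hN⟩ := Metric.tendsto_atTop.1 hlim δ hδ
  set j₀ : ℕ := max N 1 with hj₀def
  have hj₀1 : 1 ≤ j₀ := le_max_right _ _
  have hj₀N : N ≤ j₀ := le_max_left _ _
  -- the dyadic thresholds
  set d : ℕ → ℝ := fun k => (1 / 2 : ℝ) ^ (2 ^ k) / C with hddef
  have hd0 : ∀ k, 0 ≤ d k := fun k => by positivity
  have hP : ∀ k : ℕ, ∀ i : ℕ, 2 ^ k * j₀ ≤ i → u i ≤ d k := by
    intro k
    induction k with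
    | zero =>
      intro i hi
      have hi' : N ≤ i := by rw [pow_zero, one_mul] at hi; exact hj₀N.trans hi
      have := hN i hi'
      rw [Real.dist_eq, sub_zero, abs_of_nonneg (hu i)] at this
      have hd : d 0 = δ := by
        simp only [hddef, hδdef, pow_zero, pow_one]
        rw [div_div, one_div]
      rw [hd]; exact this.le
    | succ k ih =>
      intro i hi
      have hi1 : 1 ≤ i := by
        have : 1 ≤ 2 ^ (k + 1) * j₀ := Nat.one_le_iff_ne_zero.2 (by positivity)
        exact this.trans hi
      have ht : ∀ l, i ≤ l → a l ≤ K * d k ^ 2 := by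
        intro l hl
        have hn1 : 1 ≤ l + 1 - 2 ^ k * j₀ := by
          have : 2 ^ k * j₀ ≤ l := by
            calc 2 ^ k * j₀ ≤ 2 ^ (k + 1) * j₀ := Nat.mul_le_mul_right _ (Nat.pow_le_pow_right (by norm_num) (by omega))
              _ ≤ l := hi.trans hl
          omega
        have hm1 : 1 ≤ 2 ^ k * j₀ := Nat.one_le_iff_ne_zero.2 (by positivity)
        have hcut := hC (2 ^ k * j₀) (l + 1 - 2 ^ k * j₀) hm1 hn1
        have hidx : 2 ^ k * j₀ + (l + 1 - 2 ^ k * j₀) - 1 = l := by omega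
        rw [hidx] at hcut
        have hu1 : u (2 ^ k * j₀) ≤ d k := ih _ le_rfl
        have hu2 : u (l + 1 - 2 ^ k * j₀) ≤ d k := by
          apply ih
          have : 2 ^ (k + 1) * j₀ = 2 ^ k * j₀ + 2 ^ k * j₀ := by rw [pow_succ]; ring
          omega
        calc a l ≤ K * u (2 ^ k * j₀) * u (l + 1 - 2 ^ k * j₀) := hcut
          _ ≤ K * d k * d k := by
              have := hu (2 ^ k * j₀); have := hu (l + 1 - 2 ^ k * j₀)
              gcongr
          _ = K * d k ^ 2 := by ring
      have hb := le_of_forall_coeff_le ha hq hκ.le hE hR hi1 ht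
      calc u i ≤ κ * (K * d k ^ 2) * (q / (q - 1)) := hb
        _ = C * d k ^ 2 := by rw [hCdef]; ring
        _ = d (k + 1) := by
            simp only [hddef]
            rw [div_pow, ← pow_mul, ← pow_succ]
            field_simp
  -- block sums
  have hQ : ∀ n : ℕ, ∑ i ∈ Ico j₀ (2 ^ n * j₀), u i ≤ (j₀ : ℝ) / C * ∑ k ∈ range n, (2 : ℝ) ^ k * (1 / 2) ^ (2 ^ k) := by
    intro n
    induction n with
    | zero => simp
    | succ n ih =>
      have h1 : j₀ ≤ 2 ^ n * j₀ := Nat.le_mul_of_pos_left _ (by positivity)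
      have h2 : 2 ^ n * j₀ ≤ 2 ^ (n + 1) * j₀ := Nat.mul_le_mul_right _ (Nat.pow_le_pow_right (by norm_num) (by omega))
      rw [← Finset.sum_Ico_consecutive _ h1 h2, Finset.sum_range_succ, mul_add]
      have hblock : ∑ i ∈ Ico (2 ^ n * j₀) (2 ^ (n + 1) * j₀), u i ≤ (j₀ : ℝ) / C * ((2 : ℝ) ^ n * (1 / 2) ^ (2 ^ n)) := by
        have hle : ∀ i ∈ Ico (2 ^ n * j₀) (2 ^ (n + 1) * j₀), u i ≤ d n := by
          intro i hi
          rw [Finset.mem_Ico] at hi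
          exact hP n i hi.1
        have hs := Finset.sum_le_card_nsmul _ _ _ hle
        rw [Nat.card_Ico, nsmul_eq_mul] at hs
        have hcard : ((2 ^ (n + 1) * j₀ - 2 ^ n * j₀ : ℕ) : ℝ) = (2 : ℝ) ^ n * j₀ := by
          have : 2 ^ (n + 1) * j₀ - 2 ^ n * j₀ = 2 ^ n * j₀ := by
            have : 2 ^ (n + 1) * j₀ = 2 ^ n * j₀ + 2 ^ n * j₀ := by rw [pow_succ]; ring
            omega
          rw [this]; push_cast; ring
        rw [hcard] at hs
        calc ∑ i ∈ Ico (2 ^ n * j₀) (2 ^ (n + 1) * j₀), u i ≤ (2 : ℝ) ^ n * j₀ * d n := hs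
          _ = (j₀ : ℝ) / C * ((2 : ℝ) ^ n * (1 / 2) ^ (2 ^ n)) := by simp only [hddef]; ring
      linarith
  -- total bound, contradicting divergence
  set S₀ : ℝ := ∑ m ∈ range j₀, u m with hS₀def
  obtain ⟨M, hM⟩ := hD (S₀ + (j₀ : ℝ) / C * 2)
  have hsub : range (M + 1) ⊆ range (2 ^ (M + 1) * j₀) := by
    intro x hx
    rw [Finset.mem_range] at hx ⊢
    have h1 : M + 1 ≤ 2 ^ (M + 1) := (Nat.lt_two_pow_self).le
    have h2 : 2 ^ (M + 1) ≤ 2 ^ (M + 1) * j₀ := Nat.le_mul_of_pos_right _ hj₀1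
    omega
  have htot : ∑ m ∈ range (M + 1), u m ≤ S₀ + (j₀ : ℝ) / C * 2 := by
    calc ∑ m ∈ range (M + 1), u m ≤ ∑ m ∈ range (2 ^ (M + 1) * j₀), u m :=
          Finset.sum_le_sum_of_subset_of_nonneg hsub fun i _ _ => hu i
      _ = S₀ + ∑ i ∈ Ico j₀ (2 ^ (M + 1) * j₀), u i := by
          rw [hS₀def, Finset.range_eq_Ico, Finset.range_eq_Ico, ← Finset.sum_Ico_consecutive _ (Nat.zero_le j₀)
            (Nat.le_mul_of_pos_left _ (by positivity))]
      _ ≤ S₀ + (j₀ : ℝ) / C * ∑ k ∈ range (M + 1), (2 : ℝ) ^ k * (1 / 2) ^ (2 ^ k) := by linarith [hQ (M + 1)]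
      _ ≤ S₀ + (j₀ : ℝ) / C * 2 := by
          have := sum_two_pow_mul_half_pow_le (M + 1)
          have hj : (0 : ℝ) ≤ (j₀ : ℝ) / C := by positivity
          nlinarith
  linarith

/-- ★★ BOOTSTRAP, second half: under (E), (C), (R), (D) the partial sums of `u` are at least LINEAR along a subsequence —
`∃ s > 0, ∀ M₀, ∃ M ≥ M₀, s·M ≤ Σ_{m ≤ M} u m` (`limsup S_M / M > 0`).  (A large `u j` forces a large `a i`, `i ≥ j`, by (E)+(R); by
(C) every split `m + n − 1 = i` then has `u m · u n` large, so half of `u 1, …, u i` are large.) [cite: BeatonBousquetMelouDeGierDuminilCopinGuttmann2014, Proposition 9, eq. (18) (arXiv v5 p. 14, §4.3) and §4.5 eq. (20) (p. 15); lane: the bootstrap is the lane's] -/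
theorem exists_linear_io_of_identity_cut (hu : ∀ m, 0 ≤ u m) (ha : ∀ m, 0 ≤ a m) (hq : 1 < q) (hκ : 0 < κ) (hK : 0 < K)
    (hE : ∀ m, 1 ≤ m → u m - u (m + 1) / q = κ * a m)
    (hC : ∀ m n, 1 ≤ m → 1 ≤ n → a (m + n - 1) ≤ K * u m * u n)
    (hR : Tendsto (fun N => u N / q ^ N) atTop (𝓝 0))
    (hD : ∀ B : ℝ, ∃ M : ℕ, B < ∑ m ∈ range (M + 1), u m) :
    ∃ s : ℝ, 0 < s ∧ ∀ M₀ : ℕ, ∃ M : ℕ, M₀ ≤ M ∧ s * (M : ℝ) ≤ ∑ m ∈ range (M + 1), u m := by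
  have hnt := not_tendsto_zero_of_identity_cut hu ha hq hκ hK hE hC hR hD
  rw [Metric.tendsto_atTop] at hnt
  simp only [not_forall, not_exists, not_lt, exists_prop] at hnt
  obtain ⟨ε, hε, hfreq⟩ := hnt
  have hq0 : 0 < q := by linarith
  have hq1 : 0 < q - 1 := by linarith
  set t₀ : ℝ := ε * (q - 1) / (2 * κ * q) with ht₀def
  have ht₀ : 0 < t₀ := by positivity
  set p : ℝ := t₀ / K with hpdef
  have hp : 0 < p := by positivity
  refine ⟨Real.sqrt p / 2, by positivity, fun M₀ => ?_⟩
  obtain ⟨j, hj, hεj⟩ := hfreq (max M₀ 1)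
  rw [Real.dist_eq, sub_zero, abs_of_nonneg (hu j)] at hεj
  have hj1 : 1 ≤ j := (le_max_right _ _).trans hj
  obtain ⟨i, hji, hai⟩ := exists_large_coeff ha hq hκ hE hR hj1 hε hεj
  refine ⟨i, ((le_max_left _ _).trans hj).trans hji, ?_⟩
  -- every split of `i` has a large factor
  have hpair : ∀ m ∈ range i, Real.sqrt p ≤ u (m + 1) + u (i - m) := by
    intro m hm
    rw [Finset.mem_range] at hm
    have hcut := hC (m + 1) (i - m) (by omega) (by omega)
    have hidx : m + 1 + (i - m) - 1 = i := by omega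
    rw [hidx] at hcut
    have hprod : p < u (m + 1) * u (i - m) := by
      rw [hpdef, div_lt_iff₀ hK]
      nlinarith
    by_contra! hlt
    have h1 : u (m + 1) < Real.sqrt p := by linarith [hu (i - m)]
    have h2 : u (i - m) < Real.sqrt p := by linarith [hu (m + 1)]
    have h3 : u (m + 1) * u (i - m) < Real.sqrt p * Real.sqrt p := mul_lt_mul'' h1 h2 (hu _) (hu _)
    rw [Real.mul_self_sqrt hp.le] at h3
    linarith
  have hsum : (i : ℝ) * Real.sqrt p ≤ ∑ m ∈ range i, (u (m + 1) + u (i - m)) := by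
    have := Finset.card_nsmul_le_sum _ _ _ hpair
    rwa [Finset.card_range, nsmul_eq_mul] at this
  have hrefl : ∑ m ∈ range i, u (i - m) = ∑ m ∈ range i, u (m + 1) := by
    rw [← Finset.sum_range_reflect (fun m => u (m + 1)) i]
    refine Finset.sum_congr rfl fun m hm => ?_
    rw [Finset.mem_range] at hm
    congr 1; omega
  rw [Finset.sum_add_distrib, hrefl] at hsum
  rw [Finset.sum_range_succ']
  have hu0 := hu 0
  linarith

/-- ★★★ UPGRADE UNDER BOUNDEDNESS: if moreover `u ≤ U`, then `u` is bounded BELOW by a positive constant on `m ≥ 1` — hence the linear law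
for ALL `M` with `Θ(1)` coefficients.  (A good `u j ≥ ε`, `j ≥ m`, forces a large `a i`, `i ≥ j`; the split `m + (i+1−m) − 1 = i` of (C′)
gives `K · u m · U ≥ K · u m · u (i+1−m) > t₀`.) [cite: BeatonBousquetMelouDeGierDuminilCopinGuttmann2014, Proposition 9, eq. (18) (arXiv v5 p. 14, §4.3) and §4.5 eq. (20) (p. 15); lane: the bootstrap is the lane's] -/
theorem exists_pos_le_of_bounded (hu : ∀ m, 0 ≤ u m) (ha : ∀ m, 0 ≤ a m) (hq : 1 < q) (hκ : 0 < κ) (hK : 0 < K)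
    (hE : ∀ m, 1 ≤ m → u m - u (m + 1) / q = κ * a m)
    (hC : ∀ m n, 1 ≤ m → 1 ≤ n → a (m + n - 1) ≤ K * u m * u n)
    (hR : Tendsto (fun N => u N / q ^ N) atTop (𝓝 0))
    (hD : ∀ B : ℝ, ∃ M : ℕ, B < ∑ m ∈ range (M + 1), u m) {U : ℝ} (hU : ∀ m, u m ≤ U) :
    ∃ c : ℝ, 0 < c ∧ ∀ m : ℕ, 1 ≤ m → c ≤ u m := by
  have hnt := not_tendsto_zero_of_identity_cut hu ha hq hκ hK hE hC hR hD
  rw [Metric.tendsto_atTop] at hnt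
  simp only [not_forall, not_exists, not_lt, exists_prop] at hnt
  obtain ⟨ε, hε, hfreq⟩ := hnt
  have hq0 : 0 < q := by linarith
  have hq1 : 0 < q - 1 := by linarith
  set t₀ : ℝ := ε * (q - 1) / (2 * κ * q) with ht₀def
  have ht₀ : 0 < t₀ := by positivity
  have hU1 : 0 < max U 1 := lt_max_of_lt_right one_pos
  refine ⟨t₀ / (K * max U 1), by positivity, fun m hm => ?_⟩
  obtain ⟨j, hj, hεj⟩ := hfreq m
  rw [Real.dist_eq, sub_zero, abs_of_nonneg (hu j)] at hεj
  obtain ⟨i, hji, hai⟩ := exists_large_coeff ha hq hκ hE hR (hm.trans hj) hε hεj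
  have hcut := hC m (i + 1 - m) hm (by omega)
  have hidx : m + (i + 1 - m) - 1 = i := by omega
  rw [hidx] at hcut
  have h1 : u (i + 1 - m) ≤ max U 1 := (hU _).trans (le_max_left _ _)
  have h2 : K * u m * u (i + 1 - m) ≤ K * u m * max U 1 :=
    mul_le_mul_of_nonneg_left h1 (mul_nonneg hK.le (hu m))
  rw [div_le_iff₀ (by positivity)]
  nlinarith

/-- Corollary: under boundedness the partial sums are linear for ALL `M`: `c·M ≤ Σ_{m ≤ M} u m`.
[cite: BeatonBousquetMelouDeGierDuminilCopinGuttmann2014, Proposition 9, eq. (18) (arXiv v5 p. 14, §4.3) and §4.5 eq. (20) (p. 15); lane: the bootstrap is the lane's] -/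
theorem exists_linear_le_partialSum_of_bounded (hu : ∀ m, 0 ≤ u m) (ha : ∀ m, 0 ≤ a m) (hq : 1 < q) (hκ : 0 < κ) (hK : 0 < K)
    (hE : ∀ m, 1 ≤ m → u m - u (m + 1) / q = κ * a m)
    (hC : ∀ m n, 1 ≤ m → 1 ≤ n → a (m + n - 1) ≤ K * u m * u n)
    (hR : Tendsto (fun N => u N / q ^ N) atTop (𝓝 0))
    (hD : ∀ B : ℝ, ∃ M : ℕ, B < ∑ m ∈ range (M + 1), u m) {U : ℝ} (hU : ∀ m, u m ≤ U) :
    ∃ c : ℝ, 0 < c ∧ ∀ M : ℕ, c * (M : ℝ) ≤ ∑ m ∈ range (M + 1), u m := by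
  obtain ⟨c, hc, hcm⟩ := exists_pos_le_of_bounded hu ha hq hκ hK hE hC hR hD hU
  refine ⟨c, hc, fun M => ?_⟩
  rw [Finset.sum_range_succ']
  have h1 : ∑ m ∈ range M, c ≤ ∑ m ∈ range M, u (m + 1) := Finset.sum_le_sum fun m _ => hcm (m + 1) (by omega)
  rw [Finset.sum_const, Finset.card_range, nsmul_eq_mul] at h1
  have hu0 := hu 0
  linarith

end Literature.Probability.RandomPlanarGeometry.SAW.ThresholdBootstrap



/-! ## §2 The lane dictionary: bridges and arches of the Duminil-Copin–Smirnov strip at `x = x_c`, `y` near `y_T`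

`u m := β_{T,m} · y_T^m`, `a m := α_{T,m} · y_T^m`, `q := y_T / y* > 1` (`HV.yStar_lt_stripYT`), and the two HYPOTHESES (NOT
proved here): the coefficient identity (E) of Proposition 9, eq. (18) (the named door `StripCoeffIdentity`), and the contact-indexed arch
cut (C) (an explicit binder `hC` in each theorem).  The radius condition (R) and the
divergence (D) are theorems of the tree (`HV.hasSum_stripBcoeff_of_lt_stripYT` at `y* < y_T`; THRESHOLD+
`HV.exists_sqrt_le_stripGFy_beta_stripYT`). -/

namespace Literature.Probability.RandomPlanarGeometry.SAW.HV

variable {T : ℕ}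

/-- DOOR (E) — the COEFFICIENT IDENTITY: `∃ κ > 0, ∀ m ≥ 1, β_{T,m} − y*·β_{T,m+1} = κ·α_{T,m}`.  Informally this is Proposition 9, eq. (18) (arXiv v5 p. 14)
(`cos(3π/8) A_T(x_c; y) + ((y* − y)/(y (y* − 1))) B_T(x_c; y) = 1` for `0 ≤ y < y_T`, the `L → ∞` limit of identity (16) using
`E_{T,L} → 0`) read coefficientwise, with `κ = (y* − 1) cos(3π/8)`; the tree has (16) (`HV.stripIdentityY_holds`) and `E_{T,L} → 0`
(`HexSAWStripELimZeroY`) but not yet the coefficient extraction.  Typed here as a hypothesis; nothing in this file proves it.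
[cite: BeatonBousquetMelouDeGierDuminilCopinGuttmann2014, Proposition 9, eq. (18) (arXiv v5 p. 14, §4.3) and Proposition 4 (arXiv v5 p. 7) / eq. (16) (p. 13)] -/
def StripCoeffIdentity (T : ℕ) : Prop :=
  ∃ κ : ℝ, 0 < κ ∧ ∀ m : ℕ, 1 ≤ m → stripBcoeff T m - yStar * stripBcoeff T (m + 1) = κ * stripAcoeff T m

/-! HYPOTHESIS (C) — the CONTACT-INDEXED ARCH CUT, stated below as the explicit binder
`hC : ∃ K : ℝ, 0 < K ∧ ∀ m n : ℕ, 1 ≤ m → 1 ≤ n → stripAcoeff T (m + n - 1) ≤ K * stripBcoeff T m * stripBcoeff T n`.  Informally: cut an arch of the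
width-`T` strip with `m + n − 1` top contacts at its `m`-th top contact; the first piece is a bridge with `m` top contacts, the second,
reversed and re-based at the origin mid-edge, a bridge with `n` top contacts (the cut vertex is shared, whence `K = x_c⁻¹` up to the
lane's length conventions); the map is injective for fixed `m`.  This is the mechanism of eq. (20) ("by looking at its last contact, one
can factor the arch into two bridges"), indexed by contacts instead of widths; the tree's `HexSAWStripSurfaceArchCut` (`lcFst`, `lcSnd`,
`lc_injOn`) is the last-contact version.  A LANE statement (the printed cut is across widths), hence a binder and not a named fact;
nothing in this file proves it. (BeatonBousquetMelouDeGierDuminilCopinGuttmann2014, §4.5, eq. (20), arXiv v5 p. 15.) -/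

/-- (R) in the tree: `β_{T,N} · y*^N → 0` (the series converges at `y* < y_T`). [cite: BeatonBousquetMelouDeGierDuminilCopinGuttmann2014, Corollary 8 with §4.2 (arXiv v5 pp. 12–14: "y_T > y_c for all T", y* ≤ y_{T+1})] -/
theorem tendsto_stripBcoeff_mul_yStar_pow (hT : 1 ≤ T) :
    Tendsto (fun N => stripBcoeff T N * yStar ^ N) atTop (𝓝 0) :=
  (hasSum_stripBcoeff_of_lt_stripYT hT yStar_pos.le (yStar_lt_stripYT hT)).summable.tendsto_atTop_zero

/-- (D) in the tree: the partial sums `Σ_{m ≤ M} β_{T,m} y_T^m` are unbounded (they dominate `B_{T,N}(x_c; y_T) ≥ c√(N+1) − C`).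
[cite: BeatonBousquetMelouDeGierDuminilCopinGuttmann2014, Corollary 8, proof (arXiv v5 pp. 12–13: the strip series are rational and diverge at the radius y_T); lane: the √N lower bound is the tree's `exists_sqrt_le_stripGFy_beta_stripYT`] -/
theorem partialSum_stripBcoeff_stripYT_unbounded (hT : 1 ≤ T) (B : ℝ) :
    ∃ M : ℕ, B < ∑ m ∈ range (M + 1), stripBcoeff T m * stripYT T ^ m := by
  obtain ⟨c, hc, C, hN⟩ := exists_sqrt_le_stripGFy_beta_stripYT hT
  -- a box `N` with `B + 1 < B_{T,N}(x_c; y_T)`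
  obtain ⟨N, hNB⟩ : ∃ N : ℕ, B + 1 < stripGFy T N (IsBetaDart T) (stripYT T) := by
    set R : ℝ := (B + 1 + C) / c with hR
    refine ⟨⌈R ^ 2⌉₊, lt_of_lt_of_le ?_ (hN _)⟩
    have h1 : R ^ 2 < (⌈R ^ 2⌉₊ : ℝ) + 1 := (Nat.le_ceil _).trans_lt (lt_add_one _)
    have h2 : R < Real.sqrt ((⌈R ^ 2⌉₊ : ℝ) + 1) := by
      rcases le_or_gt R 0 with hR0 | hR0
      · exact hR0.trans_lt (Real.sqrt_pos.2 (by positivity))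
      · calc R = Real.sqrt (R ^ 2) := (Real.sqrt_sq hR0.le).symm
          _ < Real.sqrt ((⌈R ^ 2⌉₊ : ℝ) + 1) := Real.sqrt_lt_sqrt (sq_nonneg _) h1
    have h3 : c * R = B + 1 + C := by rw [hR]; field_simp
    nlinarith
  have hsum := hasSum_stripBcoeffY T N (stripYT T)
  obtain ⟨M, hM⟩ := ((hsum.tendsto_sum_nat).eventually_const_lt (sub_one_lt _ |>.trans_le le_rfl)).exists
  refine ⟨M, ?_⟩
  have hy0 : 0 ≤ stripYT T := (stripYT_pos hT).le
  calc B < stripGFy T N (IsBetaDart T) (stripYT T) - 1 := by linarith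
    _ < ∑ m ∈ range M, stripBcoeffY T N m * stripYT T ^ m := hM
    _ ≤ ∑ m ∈ range M, stripBcoeff T m * stripYT T ^ m :=
        Finset.sum_le_sum fun m _ => mul_le_mul_of_nonneg_right (stripBcoeffY_le_stripBcoeff hT N m) (pow_nonneg hy0 m)
    _ ≤ ∑ m ∈ range (M + 1), stripBcoeff T m * stripYT T ^ m :=
        Finset.sum_le_sum_of_subset_of_nonneg (Finset.range_mono (Nat.le_succ M))
          fun m _ _ => mul_nonneg (stripBcoeff_nonneg hT m) (pow_nonneg hy0 m)

/-- The abstract hypotheses (E′), (C′), (R), (D) of §1 for `u m = β_{T,m} y_T^m`, `a m = α_{T,m} y_T^m`, `q = y_T/y*`, given the two doors.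
[cite: BeatonBousquetMelouDeGierDuminilCopinGuttmann2014, Proposition 9, eq. (18) (arXiv v5 p. 14, §4.3), §4.5 eq. (20) (p. 15); lane: dictionary] -/
theorem bootstrap_hypotheses (hT : 1 ≤ T) {κ K : ℝ}
    (hE : ∀ m : ℕ, 1 ≤ m → stripBcoeff T m - yStar * stripBcoeff T (m + 1) = κ * stripAcoeff T m)
    (hC : ∀ m n : ℕ, 1 ≤ m → 1 ≤ n → stripAcoeff T (m + n - 1) ≤ K * stripBcoeff T m * stripBcoeff T n) :
    (∀ m, 0 ≤ stripBcoeff T m * stripYT T ^ m) ∧ (∀ m, 0 ≤ stripAcoeff T m * stripYT T ^ m) ∧ 1 < stripYT T / yStar ∧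
    (∀ m, 1 ≤ m → stripBcoeff T m * stripYT T ^ m - stripBcoeff T (m + 1) * stripYT T ^ (m + 1) / (stripYT T / yStar)
        = κ * (stripAcoeff T m * stripYT T ^ m)) ∧
    (∀ m n, 1 ≤ m → 1 ≤ n → stripAcoeff T (m + n - 1) * stripYT T ^ (m + n - 1)
        ≤ K / stripYT T * (stripBcoeff T m * stripYT T ^ m) * (stripBcoeff T n * stripYT T ^ n)) ∧
    Tendsto (fun N => stripBcoeff T N * stripYT T ^ N / (stripYT T / yStar) ^ N) atTop (𝓝 0) ∧
    (∀ B : ℝ, ∃ M : ℕ, B < ∑ m ∈ range (M + 1), stripBcoeff T m * stripYT T ^ m) := by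
  have hy := stripYT_pos hT
  have hys := yStar_pos
  refine ⟨fun m => mul_nonneg (stripBcoeff_nonneg hT m) (pow_nonneg hy.le m),
    fun m => mul_nonneg (stripAcoeff_nonneg hT m) (pow_nonneg hy.le m),
    (one_lt_div hys).2 (yStar_lt_stripYT hT), ?_, ?_, ?_, partialSum_stripBcoeff_stripYT_unbounded hT⟩
  · intro m hm
    have h := hE m hm
    have h1 : stripBcoeff T (m + 1) * stripYT T ^ (m + 1) / (stripYT T / yStar)
        = yStar * stripBcoeff T (m + 1) * stripYT T ^ m := by
      rw [pow_succ]; field_simp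
    rw [h1]
    calc stripBcoeff T m * stripYT T ^ m - yStar * stripBcoeff T (m + 1) * stripYT T ^ m
        = (stripBcoeff T m - yStar * stripBcoeff T (m + 1)) * stripYT T ^ m := by ring
      _ = κ * stripAcoeff T m * stripYT T ^ m := by rw [h]
      _ = κ * (stripAcoeff T m * stripYT T ^ m) := by ring
  · intro m n hm hn
    have hcut := hC m n hm hn
    have hpow : stripYT T ^ m * stripYT T ^ n = stripYT T ^ (m + n - 1) * stripYT T := by
      rw [← pow_succ, ← pow_add]; congr 1; omega
    have h1 : K / stripYT T * (stripBcoeff T m * stripYT T ^ m) * (stripBcoeff T n * stripYT T ^ n)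
        = K * stripBcoeff T m * stripBcoeff T n * stripYT T ^ (m + n - 1) := by
      calc K / stripYT T * (stripBcoeff T m * stripYT T ^ m) * (stripBcoeff T n * stripYT T ^ n)
          = K * stripBcoeff T m * stripBcoeff T n * (stripYT T ^ m * stripYT T ^ n) / stripYT T := by ring
        _ = K * stripBcoeff T m * stripBcoeff T n * stripYT T ^ (m + n - 1) := by rw [hpow]; field_simp
    rw [h1]
    exact mul_le_mul_of_nonneg_right hcut (pow_nonneg hy.le _)
  · refine (tendsto_stripBcoeff_mul_yStar_pow hT).congr fun N => ?_
    rw [div_pow]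
    field_simp

/-- ★ THE BRIDGE COEFFICIENTS AT THE THRESHOLD DO NOT DECAY (given the two doors): `β_{T,m}·y_T^m ↛ 0`.  No rationality, no
Perron–Frobenius: identity (E) + one cut (C) + the radius at `y*` + the `√L` law.
[cite: BeatonBousquetMelouDeGierDuminilCopinGuttmann2014, Proposition 9, eq. (18) (arXiv v5 p. 14, §4.3), §4.5 eq. (20) (p. 15); lane: conditional on StripCoeffIdentity and the cut hypothesis hC] -/
theorem not_tendsto_zero_stripBcoeff_mul_stripYT_pow (hT : 1 ≤ T) (hE : StripCoeffIdentity T)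
    (hC : ∃ K : ℝ, 0 < K ∧ ∀ m n : ℕ, 1 ≤ m → 1 ≤ n → stripAcoeff T (m + n - 1) ≤ K * stripBcoeff T m * stripBcoeff T n) :
    ¬ Tendsto (fun m => stripBcoeff T m * stripYT T ^ m) atTop (𝓝 0) := by
  obtain ⟨κ, hκ, hE⟩ := hE
  obtain ⟨K, hK, hC⟩ := hC
  obtain ⟨hu, ha, hq, hE', hC', hR, hD⟩ := bootstrap_hypotheses hT hE hC
  exact ThresholdBootstrap.not_tendsto_zero_of_identity_cut hu ha hq hκ (div_pos hK (stripYT_pos hT)) hE' hC' hR hD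

/-- ★★ LINEAR LOWER LAW ALONG A SUBSEQUENCE (given the two doors): `∃ s > 0, ∀ M₀, ∃ M ≥ M₀, s·M ≤ Σ_{m ≤ M} β_{T,m} y_T^m`, i.e.
`limsup_M (1/M) Σ_{m ≤ M} β_{T,m} y_T^m > 0` — for EVERY `T ≥ 1`, with no rationality input (compare the lane's conditional linear law from
`StripBridgeSeriesRational`).  Via the lane's coefficient transfer this is `limsup_L B_{T,L}(x_c; y_T)/L > 0`.
[cite: BeatonBousquetMelouDeGierDuminilCopinGuttmann2014, Proposition 9, eq. (18) (arXiv v5 p. 14, §4.3), §4.5 eq. (20) (p. 15); lane: conditional on StripCoeffIdentity and the cut hypothesis hC] -/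
theorem exists_linear_io_partialSum_stripBcoeff_stripYT (hT : 1 ≤ T) (hE : StripCoeffIdentity T)
    (hC : ∃ K : ℝ, 0 < K ∧ ∀ m n : ℕ, 1 ≤ m → 1 ≤ n → stripAcoeff T (m + n - 1) ≤ K * stripBcoeff T m * stripBcoeff T n) :
    ∃ s : ℝ, 0 < s ∧ ∀ M₀ : ℕ, ∃ M : ℕ, M₀ ≤ M ∧ s * (M : ℝ) ≤ ∑ m ∈ range (M + 1), stripBcoeff T m * stripYT T ^ m := by
  obtain ⟨κ, hκ, hE⟩ := hE
  obtain ⟨K, hK, hC⟩ := hC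
  obtain ⟨hu, ha, hq, hE', hC', hR, hD⟩ := bootstrap_hypotheses hT hE hC
  exact ThresholdBootstrap.exists_linear_io_of_identity_cut hu ha hq hκ (div_pos hK (stripYT_pos hT)) hE' hC' hR hD

/-- Growth control from door (E) alone: `β_{T,m+1} ≤ β_{T,m} / y*` for `m ≥ 1`. [cite: BeatonBousquetMelouDeGierDuminilCopinGuttmann2014, Proposition 9, eq. (18) (arXiv v5 p. 14, §4.3); lane: conditional on StripCoeffIdentity] -/
theorem stripBcoeff_succ_le_of_identity (hT : 1 ≤ T) (hE : StripCoeffIdentity T) {m : ℕ} (hm : 1 ≤ m) :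
    stripBcoeff T (m + 1) ≤ stripBcoeff T m / yStar := by
  obtain ⟨κ, hκ, hE⟩ := hE
  have h := hE m hm
  have h1 : 0 ≤ κ * stripAcoeff T m := mul_nonneg hκ.le (stripAcoeff_nonneg hT m)
  rw [le_div_iff₀ yStar_pos]
  linarith

/-! HYPOTHESIS (B) — BOUNDED NORMALISED COEFFICIENTS, stated below as the explicit binder `hB : ∃ U : ℝ, ∀ m : ℕ, stripBcoeff T m * stripYT T ^ m ≤ U`.
By the lane's coefficient transfer this is the linear UPPER law `B_{T,L}(x_c; y_T) ≤ C·(L+1)`, i.e. the easy half of "the pole at y_T is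
simple"; it is an OPEN lane statement of Perron–Frobenius strength — a binder, not a named fact; print does not discuss the order of
divergence at `y_T` at all (Corollary 8 and its proof, arXiv v5 pp. 12–13, give rationality and divergence at the radius). -/

/-- ★★★ Given the doors (E), (C) and hypothesis (B): the coefficients at the threshold are bounded BELOW — `∃ c > 0, ∀ m ≥ 1, c ≤ β_{T,m}·y_T^m`
(two-sided `Θ(1)` with (B)).  So the linear UPPER law implies the linear LOWER law, for every `T ≥ 1`, without rationality.
[cite: BeatonBousquetMelouDeGierDuminilCopinGuttmann2014, Proposition 9, eq. (18) (arXiv v5 p. 14, §4.3), §4.5 eq. (20) (p. 15); lane: conditional on StripCoeffIdentity, the cut hypothesis hC and the boundedness hypothesis hB] -/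
theorem exists_pos_le_stripBcoeff_mul_stripYT_pow (hT : 1 ≤ T) (hE : StripCoeffIdentity T)
    (hC : ∃ K : ℝ, 0 < K ∧ ∀ m n : ℕ, 1 ≤ m → 1 ≤ n → stripAcoeff T (m + n - 1) ≤ K * stripBcoeff T m * stripBcoeff T n)
    (hB : ∃ U : ℝ, ∀ m : ℕ, stripBcoeff T m * stripYT T ^ m ≤ U) :
    ∃ c : ℝ, 0 < c ∧ ∀ m : ℕ, 1 ≤ m → c ≤ stripBcoeff T m * stripYT T ^ m := by
  obtain ⟨κ, hκ, hE⟩ := hE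
  obtain ⟨K, hK, hC⟩ := hC
  obtain ⟨U, hU⟩ := hB
  obtain ⟨hu, ha, hq, hE', hC', hR, hD⟩ := bootstrap_hypotheses hT hE hC
  exact ThresholdBootstrap.exists_pos_le_of_bounded hu ha hq hκ (div_pos hK (stripYT_pos hT)) hE' hC' hR hD hU

/-- ★★★ (R2) under (E), (C), (B): the linear lower law for ALL `M` — `∃ c > 0, ∀ M, c·M ≤ Σ_{m ≤ M} β_{T,m}·y_T^m`.
[cite: BeatonBousquetMelouDeGierDuminilCopinGuttmann2014, Proposition 9, eq. (18) (arXiv v5 p. 14, §4.3), §4.5 eq. (20) (p. 15); lane: conditional on StripCoeffIdentity, the cut hypothesis hC and the boundedness hypothesis hB] -/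
theorem exists_linear_le_partialSum_stripBcoeff_stripYT (hT : 1 ≤ T) (hE : StripCoeffIdentity T)
    (hC : ∃ K : ℝ, 0 < K ∧ ∀ m n : ℕ, 1 ≤ m → 1 ≤ n → stripAcoeff T (m + n - 1) ≤ K * stripBcoeff T m * stripBcoeff T n)
    (hB : ∃ U : ℝ, ∀ m : ℕ, stripBcoeff T m * stripYT T ^ m ≤ U) :
    ∃ c : ℝ, 0 < c ∧ ∀ M : ℕ, c * (M : ℝ) ≤ ∑ m ∈ range (M + 1), stripBcoeff T m * stripYT T ^ m := by
  obtain ⟨κ, hκ, hE⟩ := hE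
  obtain ⟨K, hK, hC⟩ := hC
  obtain ⟨U, hU⟩ := hB
  obtain ⟨hu, ha, hq, hE', hC', hR, hD⟩ := bootstrap_hypotheses hT hE hC
  exact ThresholdBootstrap.exists_linear_le_partialSum_of_bounded hu ha hq hκ (div_pos hK (stripYT_pos hT)) hE' hC' hR hD hU

end Literature.Probability.RandomPlanarGeometry.SAW.HV

end
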